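import Literature.MathematicalPhysics.QuantumFieldTheory.Balaban1983to89.B9Eq349ConjugatedQLettersCompanion
import Literature.MathematicalPhysics.QuantumFieldTheory.Balaban1983to89.B9Eq316TowerFlatIsOneStep

/-!
# `Balaban1983to89.B9Eq349TowerCutoffReadings` — T. Bałaban, *Propagators for lattice gauge theories in a background field*, Commun. Math. Phys. **99**
# (1985) 389–434 [Balaban1985BackgroundPropagators] (3.15)–(3.19) p. 393 (the composite averagings over the sequence of lattices `L^jη ℤ^d`), (3.49) p. 399,
# (3.101)–(3.103) p. 414, with [Balaban1985Averaging] (1)–(2) p. 17: **THE PER-LEVEL CUT-OFFS OF THE TOWER CONJUGATION AND THEIR TWO-BLOCK READINGS** —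
# for ONE physical cut-off `χ` on the finest lattice `T_{L^{n+1}m}` with bond increments `≤ ι`, the level-`j` cut-offs `χ_j := χ ∘ ι_j` (`ι_j` the corner
# embedding `z ↦ L^{n+1−j}·z` of `T_{L^j m}` into `T_{L^{n+1}m}`, `1 ≤ j ≤ n+1`) have the consecutive TWO-BLOCK READINGS
# `|χ_j(c₋) − χ_{j+1}(b₋)| ≤ 2d·L^{n+1−j}·ι` for `b₋ ∈ B(c₋) ∪ B(c₊)` — the displayed data `χ_j`, `ℓ′_j` of gen 93's tower letter
# `B9Eq349ConjugatedQTowerLetters.norm_conj_QkW_sub_le` (`Σ_j ℓ′_j ≤ 2dι·L^{n+1}·L∕(L−1) = O(ℓ)` at `ι = ℓη`, `ηL^{n+1} = 1`), by [folklore] lattice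
# geometry: a weight with bond increments `≤ ι` is `ι`-Lipschitz along coordinate paths (`|χ x − χ y| ≤ ι·Σ_i t_i` when `y_i = (x_i + t_i) mod P_i`)

statement-level skeleton of published theorems with citation tags; proofs where landed; nothing here is a claim about the Yang–Mills mass gap

CITATION HEADER (lean-in-tree rule).  Audit cell `pub-balaban`, sub-cell `t4`, BINDER row NE9; filed by the NE9 BINDER-row OWNER lineage
`b2b-balaban-t4-ne9-p1` (gen 94).  Imports gen 94's `B9Eq349ConjugatedQLettersCompanion` (§1: `iterate_shift_apply_val_self` ∕ `iterate_shift_apply_ne` ∕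
`abs_sub_iterate_shift_le` — the straight path in ONE direction) and `B9Eq316TowerFlatIsOneStep` (`siteCast`; through it `B9Eq315QTower.towerP`,
`towerP_apply : towerP L m n i = L^n·m i`).  Sources READ first-hand (`paper:balaban1985-cmp99-background-propagators`): p. 393 (3.15)–(3.19), p. 399
(3.49), p. 414 (3.101)–(3.103); [Balaban1985Averaging] p. 17 (1)–(2).  Print conjugates nothing; the per-level cut-offs are the ROUTE's device (gen 91's
analysis (β), gen 93's telescoped tower letter) and every constant is the cell's.

WHAT IS PROVED (sorry-free; proof lane — no `def`; [folklore] `Fin`∕`ℕ` arithmetic on torus coordinates).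
* §1 **`abs_sub_le_of_coord_offsets`** — on any torus `TSite d P`: bond increments `≤ ι` and `y_i = (x_i + t_i) mod P_i` for all `i` ⟹ `|χ x − χ y| ≤
  (Σ_i t_i)·ι` (move one coordinate at a time: `Finset.induction` over the directions, each step the straight path of the companion file).
* §2 `mul_add_mod_mul` (`(L·a + ρ) mod (L·T) = L·(a mod T) + ρ` for `ρ < L`); **`level_offsets`** — for level-embedding maps `up_j` with
  `(up_j z)_i = L^{n+1−j}·z_i` (`j ≤ n+1`; their existence `exists_levelEmbedding`), a level-`j` coarse bond `c` and a level-`(j+1)` bond `b` with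
  `B(b₋) ∈ {c₋, c₊}` (`1 ≤ j`, `j ≤ n`): `(up_{j+1} b₋)_i = ((up_j c₋)_i + t_i) mod P_i` with `Σ_i t_i ≤ 2d·L^{n+1−j}`; **`abs_sub_levels_le`** — hence
  `|χ(up_j c₋) − χ(up_{j+1} b₋)| ≤ 2d·L^{n+1−j}·ι`.
* §3 `siteCast_up_one_mem_bigBlock`, `bigCentre_shift_eq_iterate`, **`abs_sub_level_zero_le`** — the level-`0` reading against a ONE-BIG-BLOCK companion
  `χ′` (`|χ′(y) − χ(x)| ≤ ℓ′` for `x` in the big block of `y`, the shape of (GBT2)∕(H1DT)∕(EH1T)'s `hQK`): `|χ′(c₋) − χ(up_1 b₋)| ≤ 3ℓ′ + L^{n+1}·ι`.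
HONEST SCOPE.  Geometry only: no operator, no background, no estimate of [B9]; the assembly with `norm_conj_QkW_sub_le` (the family `χ_0 := χ′`,
`χ_j := χ ∘ up_j`) is the next file's; NE9 NOT PRINTED ∕ NOT PROVED; row WALLED ON A MODEL (O-NE9-1; #5 UNRULED); spine PROVED 0∕9; rung (B)+1 on a
finite T⁴ — NOT infinite volume, NOT mass gap, NOT BetaPertH, NOT Clay.  HONEST DEPENDENCY: continuum YM on T⁴ ⇐ BetaPertH ∧ nine spine estimates (0/9 proved);
BetaPertH ⇐ (D1) ∧ (D4) ∧ CAP+tail.  NEW file; nothing modified.  Net new unproved facts: 0.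
-/

set_option autoImplicit false

open scoped BigOperators

namespace Literature.MathematicalPhysics.QuantumFieldTheory.Balaban1983to89.B9Eq349TowerCutoffReadings

open B4Sect5Torus (TSite)
open B9SectCLatticeCarrier (Bond bpos btgt shift shift_apply_val shift_apply_ne)
open B9Eq319QprimeTorus (fineP blockCoord)
open B9Eq315QTower (towerP towerP_apply)
open B9Eq349ConjugatedQLettersCompanion (iterate_shift_apply_val_self iterate_shift_apply_ne abs_sub_iterate_shift_le)

/-! ## §1 A bond-Lipschitz weight is Lipschitz along coordinate paths -/

section Path

variable {d : ℕ} {P : Fin d → ℕ}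

/-- Moving the coordinates in `insert μ s` is moving those in `s` and then `t_μ` unit steps in direction `μ`. [folklore]
[cite: Balaban1985Averaging, (1)–(2) p.17] -/
theorem move_insert (s : Finset (Fin d)) {μ : Fin d} (hμ : μ ∉ s) (x : TSite d P) (t : Fin d → ℕ) :
    (fun i => if i ∈ insert μ s then (⟨((x i : ℕ) + t i) % P i, Nat.mod_lt _ (x i).pos⟩ : Fin (P i)) else x i) =
      (shift μ)^[t μ] (fun i => if i ∈ s then (⟨((x i : ℕ) + t i) % P i, Nat.mod_lt _ (x i).pos⟩ : Fin (P i)) else x i) := by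
  funext i
  apply Fin.ext
  by_cases hi : i = μ
  · subst hi
    rw [iterate_shift_apply_val_self]
    simp only [Finset.mem_insert, true_or, if_true, hμ, if_false]
  · rw [iterate_shift_apply_ne hi]
    simp only [Finset.mem_insert, hi, false_or]

/-- **Along the coordinates of `s`**: `|χ x − χ (x moved by t on s)| ≤ (Σ_{i∈s} t_i)·ι`. [folklore] [cite: Balaban1985BackgroundPropagators, (3.49) p.399, (3.101) p.414] -/
theorem abs_sub_move_le (χ : TSite d P → ℝ) {ι : ℝ} (hχ : ∀ b : Bond d P, |χ (bpos b) - χ (btgt b)| ≤ ι) (x : TSite d P) (t : Fin d → ℕ)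
    (s : Finset (Fin d)) :
    |χ x - χ (fun i => if i ∈ s then (⟨((x i : ℕ) + t i) % P i, Nat.mod_lt _ (x i).pos⟩ : Fin (P i)) else x i)| ≤ (∑ i ∈ s, (t i : ℝ)) * ι := by
  classical
  induction s using Finset.induction_on with
  | empty =>
    have h0 : (fun i => if i ∈ (∅ : Finset (Fin d)) then (⟨((x i : ℕ) + t i) % P i, Nat.mod_lt _ (x i).pos⟩ : Fin (P i)) else x i) = x := by
      funext i; simp
    rw [h0]; simp
  | insert μ s hμ ih =>
    rw [move_insert s hμ x t, Finset.sum_insert hμ, add_mul]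
    have hpath := abs_sub_iterate_shift_le χ hχ
      (fun i => if i ∈ s then (⟨((x i : ℕ) + t i) % P i, Nat.mod_lt _ (x i).pos⟩ : Fin (P i)) else x i) μ (t μ)
    calc _ ≤ |χ x - χ (fun i => if i ∈ s then (⟨((x i : ℕ) + t i) % P i, Nat.mod_lt _ (x i).pos⟩ : Fin (P i)) else x i)| +
          |χ (fun i => if i ∈ s then (⟨((x i : ℕ) + t i) % P i, Nat.mod_lt _ (x i).pos⟩ : Fin (P i)) else x i) -
            χ ((shift μ)^[t μ] (fun i => if i ∈ s then (⟨((x i : ℕ) + t i) % P i, Nat.mod_lt _ (x i).pos⟩ : Fin (P i)) else x i))| :=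
          abs_sub_le _ _ _
      _ ≤ (∑ i ∈ s, (t i : ℝ)) * ι + (t μ : ℝ) * ι := add_le_add ih hpath
      _ = (t μ : ℝ) * ι + (∑ i ∈ s, (t i : ℝ)) * ι := add_comm _ _

/-- **A BOND-LIPSCHITZ WEIGHT IS LIPSCHITZ ALONG COORDINATE PATHS: `|χ x − χ y| ≤ (Σ_i t_i)·ι` whenever `y_i = (x_i + t_i) mod P_i` for all `i`.**
[folklore] [cite: Balaban1985BackgroundPropagators, (3.49) p.399, (3.101) p.414] -/
theorem abs_sub_le_of_coord_offsets (χ : TSite d P → ℝ) {ι : ℝ} (hχ : ∀ b : Bond d P, |χ (bpos b) - χ (btgt b)| ≤ ι) (x y : TSite d P)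
    (t : Fin d → ℕ) (hy : ∀ i, (y i : ℕ) = ((x i : ℕ) + t i) % P i) : |χ x - χ y| ≤ (∑ i, (t i : ℝ)) * ι := by
  classical
  have h : y = (fun i => if i ∈ (Finset.univ : Finset (Fin d)) then (⟨((x i : ℕ) + t i) % P i, Nat.mod_lt _ (x i).pos⟩ : Fin (P i)) else x i) := by
    funext i; apply Fin.ext; simp [hy i]
  rw [h]
  exact abs_sub_move_le χ hχ x t Finset.univ

end Path

/-! ## §2 The level embeddings and the consecutive two-block readings (levels `j ≥ 1`) -/

section Levels

variable {d : ℕ} (L : ℕ) (m : Fin d → ℕ)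

/-- `(L·a + ρ) mod (L·T) = L·(a mod T) + ρ` for `ρ < L`. [folklore] [cite: Balaban1985Averaging, (2) p.17] -/
theorem mul_add_mod_mul {T ρ : ℕ} (hT : 0 < T) (hρ : ρ < L) (a : ℕ) : (L * a + ρ) % (L * T) = L * (a % T) + ρ := by
  have h1 : L * a + ρ = L * T * (a / T) + (L * (a % T) + ρ) := by
    have := Nat.div_add_mod a T
    calc L * a + ρ = L * (T * (a / T) + a % T) + ρ := by rw [this]
      _ = L * T * (a / T) + (L * (a % T) + ρ) := by ring
  have h2 : L * (a % T) + ρ < L * T := by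
    have hlt : a % T < T := Nat.mod_lt _ hT
    have : a % T + 1 ≤ T := hlt
    calc L * (a % T) + ρ < L * (a % T) + L := by omega
      _ = L * (a % T + 1) := by ring
      _ ≤ L * T := Nat.mul_le_mul_left _ this
  rw [h1, Nat.mul_add_mod_self_left, Nat.mod_eq_of_lt h2]

/-- **THE LEVEL EMBEDDINGS EXIST**: maps `up_j : T_{L^j m} → T_{L^{n+1} m}` with `(up_j z)_i = L^{n+1−j}·z_i` for `j ≤ n+1` (the corner of the image
block). [folklore] [cite: Balaban1985Averaging, (1)–(2) p.17; Balaban1985BackgroundPropagators, (3.15) p.393] -/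
theorem exists_levelEmbedding (hL : 1 ≤ L) (hm : ∀ i, 1 ≤ m i) (n : ℕ) :
    ∃ up : (j : ℕ) → TSite d (towerP L m j) → TSite d (towerP L m (n + 1)),
      ∀ j, j ≤ n + 1 → ∀ (z : TSite d (towerP L m j)) (i : Fin d), ((up j z i : ℕ)) = L ^ (n + 1 - j) * (z i : ℕ) := by
  have hP : ∀ i, 0 < towerP L m (n + 1) i := fun i => by
    rw [towerP_apply]; exact Nat.mul_pos (Nat.pow_pos (by omega)) (hm i)
  refine ⟨fun j z i => ⟨(L ^ (n + 1 - j) * (z i : ℕ)) % towerP L m (n + 1) i, Nat.mod_lt _ (hP i)⟩, fun j hj z i => ?_⟩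
  show (L ^ (n + 1 - j) * (z i : ℕ)) % towerP L m (n + 1) i = L ^ (n + 1 - j) * (z i : ℕ)
  apply Nat.mod_eq_of_lt
  have hz : (z i : ℕ) < L ^ j * m i := by rw [← towerP_apply]; exact (z i).isLt
  calc L ^ (n + 1 - j) * (z i : ℕ) < L ^ (n + 1 - j) * (L ^ j * m i) := Nat.mul_lt_mul_of_pos_left hz (Nat.pow_pos (by omega))
    _ = L ^ (n + 1) * m i := by rw [← mul_assoc, ← pow_add, Nat.sub_add_cancel hj]
    _ = towerP L m (n + 1) i := (towerP_apply L m (n + 1) i).symm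

variable {L m}

/-- **THE COORDINATE OFFSETS BETWEEN CONSECUTIVE LEVELS**: for `1 ≤ j ≤ n`... more precisely for `j + 1 ≤ n + 1`, a level-`j` bond `c` and a
level-`(j+1)` bond `b` with `B(b₋) = c₋` or `B(b₋) = c₊`: `(up_{j+1} b₋)_i = ((up_j c₋)_i + t_i) mod P_i` with `t_i = L^{n−j}·(L·[i = μ, shifted] + (b₋)_i mod L)`,
so `t_i ≤ 2·L^{n+1−j}` — the finer bond's corner sits inside (or just beyond) the image of the coarse block. [folklore]
[cite: Balaban1985Averaging, (2) p.17; Balaban1985BackgroundPropagators, (3.15) p.393, (3.83) p.407] -/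
theorem level_offsets (hL : 1 ≤ L) (hm : ∀ i, 1 ≤ m i) {n : ℕ}
    {up : (j : ℕ) → TSite d (towerP L m j) → TSite d (towerP L m (n + 1))}
    (hup : ∀ j, j ≤ n + 1 → ∀ (z : TSite d (towerP L m j)) (i : Fin d), ((up j z i : ℕ)) = L ^ (n + 1 - j) * (z i : ℕ))
    {j : ℕ} (hj : j + 1 ≤ n + 1) (c : Bond d (towerP L m j)) (b : Bond d (towerP L m (j + 1)))
    (hb : blockCoord L (towerP L m j) b.1 = c.1 ∨ blockCoord L (towerP L m j) b.1 = shift c.2 c.1) :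
    ∃ t : Fin d → ℕ, (∀ i, t i ≤ 2 * L ^ (n + 1 - (j + 1) + 1)) ∧
      ∀ i, ((up (j + 1) b.1 i : ℕ)) = (((up j c.1 i : ℕ)) + t i) % towerP L m (n + 1) i := by
  have hL0 : 0 < L := by omega
  have hjn : j ≤ n + 1 := by omega
  have hpow : n + 1 - j = (n + 1 - (j + 1)) + 1 := by omega
  -- the block reading of `b₋`: `(b₋)_i = L·q_i + ρ_i` with `q = blockCoord b₋`
  have hdecomp : ∀ i, (b.1 i : ℕ) = L * (blockCoord L (towerP L m j) b.1 i : ℕ) + (b.1 i : ℕ) % L := fun i => by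
    rw [B9Eq319QprimeTorus.blockCoord_apply_val]; exact (Nat.div_add_mod _ _).symm
  -- `q_i = (c_i + e_i) mod T_i` with `e_i ∈ {0,1}`
  have hT : ∀ i, 0 < towerP L m j i := fun i => by
    rw [towerP_apply]; exact Nat.mul_pos (Nat.pow_pos hL0) (hm i)
  obtain ⟨e, he1, hqe⟩ : ∃ e : Fin d → ℕ, (∀ i, e i ≤ 1) ∧
      ∀ i, (blockCoord L (towerP L m j) b.1 i : ℕ) = ((c.1 i : ℕ) + e i) % towerP L m j i := by
    rcases hb with hb | hb
    · refine ⟨fun _ => 0, fun _ => zero_le_one, fun i => ?_⟩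
      have hbi : ((blockCoord L (towerP L m j) b.1 i : ℕ)) = (c.1 i : ℕ) := congrArg (fun z : TSite d (towerP L m j) => ((z i : ℕ))) hb
      rw [hbi, add_zero, Nat.mod_eq_of_lt (c.1 i).isLt]
    · refine ⟨fun i => if i = c.2 then 1 else 0, fun i => by dsimp only; split_ifs <;> omega, fun i => ?_⟩
      have hbi : ((blockCoord L (towerP L m j) b.1 i : ℕ)) = (shift c.2 c.1 i : ℕ) :=
        congrArg (fun z : TSite d (towerP L m j) => ((z i : ℕ))) hb
      rw [hbi]
      by_cases hi : i = c.2
      · subst hi; rw [shift_apply_val]; simp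
      · rw [shift_apply_ne hi]; simp [hi, Nat.mod_eq_of_lt (c.1 i).isLt]
  refine ⟨fun i => L ^ (n + 1 - (j + 1)) * (L * e i + (b.1 i : ℕ) % L), fun i => ?_, fun i => ?_⟩
  · have hρ : (b.1 i : ℕ) % L < L := Nat.mod_lt _ hL0
    have : L * e i + (b.1 i : ℕ) % L ≤ 2 * L := by have := he1 i; nlinarith
    calc L ^ (n + 1 - (j + 1)) * (L * e i + (b.1 i : ℕ) % L) ≤ L ^ (n + 1 - (j + 1)) * (2 * L) := Nat.mul_le_mul_left _ this
      _ = 2 * L ^ (n + 1 - (j + 1) + 1) := by rw [pow_succ]; ring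
  · rw [hup (j + 1) hj, hup j hjn, hdecomp i, hqe i, towerP_apply L m (n + 1) i, hpow]
    -- both sides `= L^{a}·(L·((c_i + e_i) mod T_i) + ρ_i)`, `a = n − j`, `P_i = L^{a}·(L·T_i)`
    set a := n + 1 - (j + 1) with ha
    have hTi : towerP L m j i = L ^ j * m i := towerP_apply L m j i
    have hP : L ^ (a + 1 + j) * m i = L ^ a * (L * towerP L m j i) := by
      rw [hTi]; ring
    have hsum : L ^ (a + 1) * (c.1 i : ℕ) + L ^ a * (L * e i + (b.1 i : ℕ) % L) = L ^ a * (L * ((c.1 i : ℕ) + e i) + (b.1 i : ℕ) % L) := by ring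
    have hn1 : n + 1 = a + 1 + j := by omega
    rw [hn1, hP, hsum, Nat.mul_mod_mul_left, mul_add_mod_mul L (hT i) (Nat.mod_lt _ hL0)]

/-- **THE CONSECUTIVE TWO-BLOCK READINGS OF THE PER-LEVEL CUT-OFFS `χ_j := χ ∘ up_j` (`1 ≤ j`, pair `(j, j+1)`, `j ≤ n`):
`|χ(up_j c₋) − χ(up_{j+1} b₋)| ≤ (2d·L^{n+1−j})·ι` for `B(b₋) ∈ {c₋, c₊}`** — the `hχ`∕`ℓ′_j` data of `B9Eq349ConjugatedQTowerLetters.norm_conj_QkW_sub_le`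
for the levels `j ≥ 1` (`ℓ′_j = 2d·L^{n+1−j}·ι`). [folklore] [cite: Balaban1985BackgroundPropagators, (3.15)–(3.19) p.393, (3.49) p.399, (3.101) p.414] -/
theorem abs_sub_levels_le (hL : 1 ≤ L) (hm : ∀ i, 1 ≤ m i) {n : ℕ}
    {up : (j : ℕ) → TSite d (towerP L m j) → TSite d (towerP L m (n + 1))}
    (hup : ∀ j, j ≤ n + 1 → ∀ (z : TSite d (towerP L m j)) (i : Fin d), ((up j z i : ℕ)) = L ^ (n + 1 - j) * (z i : ℕ))
    (χ : TSite d (towerP L m (n + 1)) → ℝ) {ι : ℝ} (hι : 0 ≤ ι) (hχ : ∀ b : Bond d (towerP L m (n + 1)), |χ (bpos b) - χ (btgt b)| ≤ ι)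
    {j : ℕ} (hj : j + 1 ≤ n + 1) (c : Bond d (towerP L m j)) (b : Bond d (towerP L m (j + 1)))
    (hb : blockCoord L (towerP L m j) b.1 = c.1 ∨ blockCoord L (towerP L m j) b.1 = shift c.2 c.1) :
    |χ (up j c.1) - χ (up (j + 1) b.1)| ≤ (2 * d * L ^ (n + 1 - (j + 1) + 1)) * ι := by
  obtain ⟨t, ht, hcoord⟩ := level_offsets hL hm hup hj c b hb
  have h := abs_sub_le_of_coord_offsets χ hχ (up j c.1) (up (j + 1) b.1) t hcoord
  refine h.trans (mul_le_mul_of_nonneg_right ?_ hι)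
  calc ∑ i, (t i : ℝ) ≤ ∑ _i : Fin d, (2 * L ^ (n + 1 - (j + 1) + 1) : ℝ) :=
        Finset.sum_le_sum fun i _ => by exact_mod_cast ht i
    _ = 2 * d * L ^ (n + 1 - (j + 1) + 1) := by rw [Finset.sum_const, Finset.card_univ, Fintype.card_fin, nsmul_eq_mul]; ring

end Levels

/-! ## §3 The level-`0` reading against a one-big-block companion -/

section LevelZero

open B9Eq316TowerFlatIsOneStep (siteCast siteCast_apply_val towerP_eq_fineP_pow)
open B9Eq319QprimeTorus (centre mem_blockOf_iff centre_mem_blockOf)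

variable {d : ℕ} {L : ℕ} {m : Fin d → ℕ}

/-- **The image of a level-`1` site under `up_1` lies in the BIG block (side `L^{n+1}`) of its level-`0` block coordinate**:
`(L^n·z_i) div L^{n+1} = z_i div L`. [folklore] [cite: Balaban1985Averaging, (2) p.17; Balaban1985BackgroundPropagators, (3.15)–(3.19) p.393] -/
theorem siteCast_up_one_mem_bigBlock (hL : 1 ≤ L) {n : ℕ}
    {up : (j : ℕ) → TSite d (towerP L m j) → TSite d (towerP L m (n + 1))}
    (hup : ∀ j, j ≤ n + 1 → ∀ (z : TSite d (towerP L m j)) (i : Fin d), ((up j z i : ℕ)) = L ^ (n + 1 - j) * (z i : ℕ))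
    (z : TSite d (towerP L m 1)) {y : TSite d m} (hz : blockCoord L (towerP L m 0) z = y) :
    siteCast (towerP_eq_fineP_pow L m (n + 1)) (up 1 z) ∈ B9Eq319QprimeTorus.blockOf (L ^ (n + 1)) m y := by
  rw [mem_blockOf_iff]
  funext i
  apply Fin.ext
  have hyi : ((blockCoord L (towerP L m 0) z i : ℕ)) = (y i : ℕ) := congrArg (fun w : TSite d m => ((w i : ℕ))) hz
  rw [B9Eq319QprimeTorus.blockCoord_apply_val] at hyi
  rw [B9Eq319QprimeTorus.blockCoord_apply_val, siteCast_apply_val, hup 1 (by omega), ← hyi,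
    show n + 1 - 1 = n from rfl, pow_succ, Nat.mul_comm (L ^ n) L, Nat.mul_comm (L ^ n) (z i : ℕ)]
  exact Nat.mul_div_mul_right _ _ (Nat.pow_pos (by omega))

/-- **The big centres of neighbouring unit blocks are joined by the straight path of `L^{n+1}` fine bonds** (read through the site cast):
`cast⁻¹(centre (y + e_μ)) = (· + e_μ)^{L^{n+1}} (cast⁻¹(centre y))`. [folklore] [cite: Balaban1985Averaging, (2) p.17] -/
theorem bigCentre_shift_eq_iterate (L : ℕ) [NeZero L] (m : Fin d → ℕ) (n : ℕ) (μ : Fin d) (y : TSite d m) :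
    (siteCast (towerP_eq_fineP_pow L m (n + 1))).symm (centre (L ^ (n + 1)) m (shift μ y)) =
      (shift μ)^[L ^ (n + 1)] ((siteCast (towerP_eq_fineP_pow L m (n + 1))).symm (centre (L ^ (n + 1)) m y)) := by
  haveI : NeZero (L ^ (n + 1)) := ⟨pow_ne_zero _ (NeZero.ne L)⟩
  funext i
  apply Fin.ext
  rw [B9Eq316TowerFlatIsOneStep.siteCast_symm, siteCast_apply_val]
  by_cases h : i = μ
  · subst h
    rw [iterate_shift_apply_val_self, siteCast_apply_val, B9Eq319QprimeTorus.centre_apply_val, B9Eq319QprimeTorus.centre_apply_val,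
      shift_apply_val, towerP_apply]
    rw [← Nat.mul_mod_mul_left, Nat.mul_add, Nat.mul_one]
  · rw [iterate_shift_apply_ne h, siteCast_apply_val, B9Eq319QprimeTorus.centre_apply_val, B9Eq319QprimeTorus.centre_apply_val, shift_apply_ne h]

/-- **THE LEVEL-`0` READING: `|χ′(c₋) − χ(up_1 b₋)| ≤ 3ℓ′ + L^{n+1}·ι` whenever `B(b₋) ∈ {c₋, c₊}`**, for a ONE-BIG-BLOCK companion `χ′` of `χ`
(`|χ′(y) − χ(x)| ≤ ℓ′` for `x` in the big block of `y`, the shape the tower ENDs display) — on `B(c₋)` the companion itself; on `B(c₊)`: `χ′(c₋) → χ(big centre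
of c₋)` → the straight path of `L^{n+1}` bonds → `χ(big centre of c₊) → χ′(c₊) → χ(up_1 b₋)`; the `j = 0` datum of `B9Eq349ConjugatedQTowerLetters.norm_conj_QkW_sub_le`
with `χ_0 := χ′` (`ℓ′_0 = 3ℓ′ + L^{n+1}ι = 3ℓ′ + ℓ` at `ι = ℓη`, `ηL^{n+1} = 1`). [folklore]
[cite: Balaban1985BackgroundPropagators, (3.15)–(3.19) p.393, (3.49) p.399, (3.83) p.407, (3.101) p.414] -/
theorem abs_sub_level_zero_le (hL : 1 ≤ L) {n : ℕ}
    {up : (j : ℕ) → TSite d (towerP L m j) → TSite d (towerP L m (n + 1))}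
    (hup : ∀ j, j ≤ n + 1 → ∀ (z : TSite d (towerP L m j)) (i : Fin d), ((up j z i : ℕ)) = L ^ (n + 1 - j) * (z i : ℕ))
    (χ : TSite d (towerP L m (n + 1)) → ℝ) {ι ℓ' : ℝ} (hι : 0 ≤ ι) (hℓ' : 0 ≤ ℓ')
    (hχ : ∀ b : Bond d (towerP L m (n + 1)), |χ (bpos b) - χ (btgt b)| ≤ ι) (χ' : TSite d m → ℝ)
    (hχ' : ∀ (y : TSite d m) (x : TSite d (towerP L m (n + 1))),
      siteCast (towerP_eq_fineP_pow L m (n + 1)) x ∈ B9Eq319QprimeTorus.blockOf (L ^ (n + 1)) m y → |χ' y - χ x| ≤ ℓ')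
    (c : Bond d (towerP L m 0)) (b : Bond d (towerP L m 1))
    (hb : blockCoord L (towerP L m 0) b.1 = c.1 ∨ blockCoord L (towerP L m 0) b.1 = shift c.2 c.1) :
    |χ' c.1 - χ (up 1 b.1)| ≤ 3 * ℓ' + L ^ (n + 1) * ι := by
  haveI : NeZero L := ⟨by omega⟩
  haveI : NeZero (L ^ (n + 1)) := ⟨pow_ne_zero _ (NeZero.ne L)⟩
  have hpos : (0 : ℝ) ≤ L ^ (n + 1) * ι := by positivity
  rcases hb with hb | hb
  · have h1 := hχ' c.1 (up 1 b.1) (siteCast_up_one_mem_bigBlock hL hup b.1 hb)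
    linarith
  · -- the two big centres, cast back to the tower typing
    have hC : ∀ y : TSite d m, siteCast (towerP_eq_fineP_pow L m (n + 1))
        ((siteCast (towerP_eq_fineP_pow L m (n + 1))).symm (centre (L ^ (n + 1)) m y)) ∈ B9Eq319QprimeTorus.blockOf (L ^ (n + 1)) m y :=
      fun y => by rw [Equiv.apply_symm_apply]; exact centre_mem_blockOf (L ^ (n + 1)) m y
    have h1 := hχ' c.1 _ (hC c.1)
    have h3 := hχ' (shift c.2 c.1) _ (hC (shift c.2 c.1))
    have h4 := hχ' (shift c.2 c.1) (up 1 b.1) (siteCast_up_one_mem_bigBlock hL hup b.1 hb)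
    have h2 : |χ ((siteCast (towerP_eq_fineP_pow L m (n + 1))).symm (centre (L ^ (n + 1)) m c.1)) -
        χ ((siteCast (towerP_eq_fineP_pow L m (n + 1))).symm (centre (L ^ (n + 1)) m (shift c.2 c.1)))| ≤ L ^ (n + 1) * ι := by
      rw [bigCentre_shift_eq_iterate L m n c.2 c.1]
      have h := abs_sub_iterate_shift_le χ hχ ((siteCast (towerP_eq_fineP_pow L m (n + 1))).symm (centre (L ^ (n + 1)) m c.1)) c.2 (L ^ (n + 1))
      exact_mod_cast h
    have h3' : |χ ((siteCast (towerP_eq_fineP_pow L m (n + 1))).symm (centre (L ^ (n + 1)) m (shift c.2 c.1))) - χ' (shift c.2 c.1)| ≤ ℓ' := by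
      rw [abs_sub_comm]; exact h3
    calc |χ' c.1 - χ (up 1 b.1)|
        ≤ |χ' c.1 - χ ((siteCast (towerP_eq_fineP_pow L m (n + 1))).symm (centre (L ^ (n + 1)) m c.1))| +
          |χ ((siteCast (towerP_eq_fineP_pow L m (n + 1))).symm (centre (L ^ (n + 1)) m c.1)) - χ (up 1 b.1)| := abs_sub_le _ _ _
      _ ≤ |χ' c.1 - χ ((siteCast (towerP_eq_fineP_pow L m (n + 1))).symm (centre (L ^ (n + 1)) m c.1))| +
          (|χ ((siteCast (towerP_eq_fineP_pow L m (n + 1))).symm (centre (L ^ (n + 1)) m c.1)) -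
              χ ((siteCast (towerP_eq_fineP_pow L m (n + 1))).symm (centre (L ^ (n + 1)) m (shift c.2 c.1)))| +
            (|χ ((siteCast (towerP_eq_fineP_pow L m (n + 1))).symm (centre (L ^ (n + 1)) m (shift c.2 c.1))) - χ' (shift c.2 c.1)| +
              |χ' (shift c.2 c.1) - χ (up 1 b.1)|)) :=
          add_le_add le_rfl ((abs_sub_le _ _ _).trans (add_le_add le_rfl (abs_sub_le _ _ _)))
      _ ≤ ℓ' + (L ^ (n + 1) * ι + (ℓ' + ℓ')) := by gcongr
      _ = 3 * ℓ' + L ^ (n + 1) * ι := by ring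

end LevelZero

end Literature.MathematicalPhysics.QuantumFieldTheory.Balaban1983to89.B9Eq349TowerCutoffReadings
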